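import Summits.Ventures.CertifiedManyBodySolver.Theses.M3PrimeEdgeSplit
import Literature.MathematicalPhysics.QuantumLattice.HubbardNNNHoppingWindowCertificateD4
import Literature.MathematicalPhysics.QuantumLattice.HubbardTTPrimeGrandCanonicalThermalStatesKMSRows

/-!
# Line `dualreplay` for crux `M3PrimeEdgeSplit.LowerEdge_ge_m4o5` (item stmt-Ventures-21721)

First-order / rounded dual certificates in KERNEL-REPLAY NORMAL FORM, on top of the SU(2)-Ward ×
affine-`D₄` window format — whose whole soundness layer is PROVED in this file.
Team lb-dual (first-order + rigorous dual rounding), seat hub-lb-dual-plan-1, 2026-08-28.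

What this file settles (no `sorry`):

* `genericSectorTorusCert_holds` — `wardk`'s stub W1: the translation-averaged torus certificate
  theorem `torus_minEnergyOn_div_ge_of_local_certificate` on an ARBITRARY nonzero subspace `K`
  invariant under `A`, `U_v`, `U_vᴴ` (the tree theorem hard-codes `K = szSector (2n) 0`);
* `wardTorus_of_generic_holds` — `wardk`'s stub W2: the torus-level Ward × `D₄` theorem on
  `K = nParticleSubmodule (2n)` (all `S^z`), charges `S^±_torus` / `N̂` / `S^z`, ONE density
  multiplier on `n_{0↑}+n_{0↓}` (`N̂ = 2n` on `K`), window Ward terms transported by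
  `spinPlus/spinMinus_commutator_fermionEmbed_toTorusEmb`;
* `wardTL_of_torus_holds` — `wardk`'s stub W3: the thermodynamic limit;
* `wardD4WindowSound_holds : WardD4WindowSound` — hence the Ward × `D₄` window format is SOUND:
  `WardD4Identity t t' U n … ∧ Λm ⪰ 0 ⟹ c − Σ‖aₖ‖ ≤ energyDensityTT' t t' U n`;
* `wardD4Identity_slack` + `conjTranspose_mul_ladderWord_eq` — PSD-slack absorption: a Gram matrix
  `Λm` on ladder words may be replaced by `Λm + g·1` at the price of `#words` residual words
  `−g·(wᵢ† ++ wᵢ)` (cost `g` each) — no new certificate slot is needed for slack.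
* `slackAbsorb_holds : WardD4WindowSound → WardSlackWindowBound` and `wardSlackWindowBound_holds` (§S, v4) —
  `fo_dual_rounding`'s stubs 1 ∘ 2 (the skeleton OF RECORD on stmt-Ventures-21721 / 22024, seat
  hub-lb-dual-plan-2): per-block PSD floors `δ_k` with SOS generator-norm weights `r k i` are absorbed EXACTLY
  (C⋆-square-root factors join the Gram slot; the constant drops by `Σ_k δ_k Σ_i (r k i)²`), against a VERBATIM
  copy of that file's `WardSlackWindowBound`; so the skeleton of record is reduced to its edition stub
  `stub_nearCert_m4o5` / `stub_nearCert_m83o100` alone;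
  `lowerRow_of_nearCert` (§R) checks exactly that: the record's EDITION statement ALONE ⟹ the certified row;
* `psdOfFactorRowsum_holds : PsdOfFactorRowsum` (§G1, v3) — complex Hermitian `Λ`, RECTANGULAR factor `L`,
  row-sum defect `g` ⟹ `Λ + g·1 ⪰ 0` (the in-ℚ PSD test for rounded first-order duals).

The statements `GenericSectorTorusCert`, `WardD4Identity`, `WardD4TorusCert`, `WardD4WindowSound`
are VERBATIM copies of `Lines/wardk.lean` (seat hub-lb-sym-plan-2), so `FoReplay.X = WardK.X` is
`rfl` and the three proofs close `wardk`'s W1–W3 as they stand.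

Registered stubs of THIS line (the only open content):

* `stub_psdOfFactorRowsum` (G1 — PROVED in v3 as `psdOfFactorRowsum_holds`; was S–M, matrix analysis): `Λ` Hermitian, `Σⱼ |(Λ − L Lᴴ)ᵢⱼ| ≤ g` for
  all `i` (rectangular `L`) ⟹ `Λ + g·1 ⪰ 0` — PSD of a rounded first-order Gram block from a float
  Cholesky / low-rank factor and ONE row-sum inequality, instead of an exact `LDLᵀ`;
* `stub_foReplayCert_m4o5` (G3, XL, computational): a Ward × `D₄` certificate at
  `(t,t',U,n) = (1,0,8,7/8)` in replay normal form (Hermitian `Λm`, factor `Lc`, defect `g`, Gram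
  operators = ladder words) of value `≥ −4/5 + g·nm` EXISTS.  Record −0.8295699476 (MENU #529):
  +0.0296 open; CAP census: footprint ≥ (5,5) words necessary.

`lowerEdge_ge_m4o5_of_hyp : PsdOfFactorRowsum → FoReplayCert_m4o5 → LowerEdge_ge_m4o5` (no sorry) and the
skeleton theorem `LowerEdge_ge_m4o5_of : LowerEdge_ge_m4o5` (from the two stubs) are kernel-checked.
No summit statement is proved here; a certified bound is a number with a certificate; nothing here
predicts superconductivity.
-/

noncomputable section

namespace Summit.Ventures.CertifiedManyBodySolver.Cruxes.LowerEdge_ge_m4o5.DualReplay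

open Matrix Finset
open Literature.MathematicalPhysics.QuantumLattice
open Literature.MathematicalPhysics.QuantumLattice.HubbardWave0
open Literature.MathematicalPhysics.QuantumLattice.ThermodynamicLimit
open Literature.Probability.LatticeModels
open Literature.MathematicalPhysics.QuantumManyBody.StateRelaxation
open scoped ComplexOrder BigOperators

/-- (As in the tree's torus certificate files and in `Lines/wardk.lean`.) -/
local instance (priority := high) instDecidableEqFermionTorusDualReplay {d L : ℕ} :
    DecidableEq (FermionTorus d L) := LinearOrder.toDecidableEq

/-! ### The shared soundness statements (verbatim copies of `Lines/wardk.lean`, W1–W3) -/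

/-- Operators on the fermionic Fock space of the torus `(ℤ/Lℤ)^d`. -/
abbrev TOp (d L : ℕ) : Type :=
  Matrix (Finset (Orb (FermionTorus d L))) (Finset (Orb (FermionTorus d L))) ℂ

/-- (Verbatim copy of `WardK.GenericSectorTorusCert`, `Lines/wardk.lean`, so that the two agree by `rfl`.)
**W1 — generic-sector translation-averaged certificate on the fermionic torus.**  The statement of
`torus_minEnergyOn_div_ge_of_local_certificate` with `szSector (2n) 0` replaced by an arbitrary
subspace `K ≠ ⊥` invariant under `A` and under the translation unitaries and their adjoints. -/
def GenericSectorTorusCert : Prop :=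
  ∀ (d L : ℕ) [NeZero L] (A : TOp d L) (_hA : A.IsHermitian)
    (K : Submodule ℂ (Fock (Orb (FermionTorus d L)))) (_hK : K ≠ ⊥)
    (_hKA : ∀ ψ ∈ K, A *ᵥ ψ ∈ K)
    (_hKT : ∀ v : TorusSite d L, ∀ ψ ∈ K, (fockTranslate v).val *ᵥ ψ ∈ K)
    (_hKT' : ∀ v : TorusSite d L, ∀ ψ ∈ K, (fockTranslate v).valᴴ *ᵥ ψ ∈ K)
    (_hAT : ∀ v : TorusSite d L, (fockTranslate v).val * A = A * (fockTranslate v).val)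
    (X : TOp d L) (_hsum : ∑ v : TorusSite d L, (fockTranslate v).val * X * (fockTranslate v).valᴴ = A)
    (δ' : Type) (dens : Finset δ') (μ ν g : δ' → ℝ) (D G : δ' → TOp d L)
    (_hD : ∀ i ∈ dens, ∑ v : TorusSite d L, (fockTranslate v).val * D i * (fockTranslate v).valᴴ = G i)
    (_hGh : ∀ i ∈ dens, (G i).IsHermitian)
    (_hG : ∀ i ∈ dens, ∀ ψ ∈ K, G i *ᵥ ψ = ((g i : ℝ) : ℂ) • ψ)
    (m : Type) (_ : Fintype m) (_ : DecidableEq m) (Λm : Matrix m m ℂ) (_hΛ : Λm.PosSemidef)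
    (O : m → TOp d L)
    (κ : Type) (s : Finset κ) (Xc : κ → TOp d L)
    (ι : Type) (tt : Finset ι) (Us Y : ι → TOp d L)
    (_hU : ∀ l ∈ tt, Us l * A = A * Us l)
    (_hUK : ∀ l ∈ tt, ∀ ψ ∈ K, Us l *ᵥ ψ ∈ K)
    (_hUK' : ∀ l ∈ tt, ∀ ψ ∈ K, (Us l)ᴴ *ᵥ ψ ∈ K)
    (_hUU : ∀ l ∈ tt, (Us l)ᴴ * Us l = 1)
    (ρ : Type) (r : Finset ρ) (Q Z Z' : ρ → TOp d L) (q : ρ → ℝ)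
    (_hQh : ∀ i ∈ r, (Q i).IsHermitian)
    (_hQ : ∀ i ∈ r, ∀ ψ ∈ K, Q i *ᵥ ψ = ((q i : ℝ) : ℂ) • ψ)
    (γ : Type) (u : Finset γ) (C W : γ → TOp d L)
    (_hC : ∀ j ∈ u, C j * A = A * C j)
    (_hCK : ∀ j ∈ u, ∀ ψ ∈ K, C j *ᵥ ψ ∈ K)
    (_hCK' : ∀ j ∈ u, ∀ ψ ∈ K, (C j)ᴴ *ᵥ ψ ∈ K)
    (δ : Type) (ah : Finset δ) (dc : δ → ℝ) (V : δ → TOp d L)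
    (κ'' : Type) (w : Finset κ'') (a : κ'' → ℂ) (M : κ'' → TOp d L)
    (_hM : ∀ k ∈ w, (M k).IsContraction) (c : ℝ),
    X - (c : ℂ) • (1 : TOp d L) - ∑ i ∈ dens, ((μ i : ℝ) : ℂ) • (D i - ((ν i : ℝ) : ℂ) • (1 : TOp d L)) =
      gramForm Λm O +
        (∑ k ∈ s, (A * Xc k - Xc k * A) +
          ∑ l ∈ tt, (Us l * Y l * (Us l)ᴴ - Y l) +
          ∑ i ∈ r, (Z i * (Q i - ((q i : ℝ) : ℂ) • 1) + (Q i - ((q i : ℝ) : ℂ) • 1) * Z' i) +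
          ∑ j ∈ u, (C j * W j - W j * C j)) +
        (∑ m' ∈ ah, ((dc m' : ℝ) : ℂ) • ((V m')ᴴ - V m') + ∑ k ∈ w, a k • M k) →
    c - ∑ k ∈ w, ‖a k‖ + ∑ i ∈ dens, μ i * (g i / (L : ℝ) ^ d - ν i) ≤
      A.minEnergyOn K / (L : ℝ) ^ d

/-- (Verbatim copy of `WardK.WardD4Identity`.) The SU(2)-Ward × affine-`D₄` window identity in `𝔄_{Λ'}` for the `t–t'` Hubbard interaction at
target density `n`, with ONE multiplier `μ` on the total site density and the two Ward null families
`Σ_r (S⁺_{Λ'} X_r − X_r S⁺_{Λ'})`, `Σ_r (S⁻_{Λ'} X'_r − X'_r S⁻_{Λ'})` added to the null terms of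
`groundEnergy_hubbardTorusTT'_div_ge_of_window_certificate_d4`. -/
def WardD4Identity (t t' U n : ℝ) {Λ Λ' : Finset (Site 2)} (hΛ : Λ ⊆ Λ')
    (h0 : thicken ({0} : Finset (Site 2)) 1 ⊆ Λ') (hz : (0 : Site 2) ∈ Λ') (μ : ℝ)
    {m : Type} [Fintype m] [DecidableEq m] (Λm : Matrix m m ℂ) (O : m → FermionOp Λ')
    {κ : Type} (s : Finset κ) (B : κ → FermionOp Λ)
    {ι : Type} (tt : Finset ι) (γ : ι → DihedralGroup 4) (wv : ι → Site 2)
    (hsh : ∀ l, d4ShiftSet (γ l) (wv l) Λ ⊆ Λ') (Y : ι → FermionOp Λ)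
    {ρ : Type} (u : Finset ρ) (b : ρ → ℂ) (cw : ρ → List (Orb (PolySite Λ') × Bool))
    {θ : Type} (wp : Finset θ) (Xp : θ → FermionOp Λ')
    {θ' : Type} (wm : Finset θ') (Xm : θ' → FermionOp Λ')
    {δ : Type} (ah : Finset δ) (dc : δ → ℝ) (V : δ → FermionOp Λ')
    {κ'' : Type} (w : Finset κ'') (a : κ'' → ℂ) (word : κ'' → List (Orb (PolySite Λ') × Bool))
    (c : ℝ) : Prop :=
  fermionEmbed (PolySite.incl h0) ((hubbardTTPrimeFermionInteraction t t' U).meanEnergyObs 1) -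
      (c : ℂ) • (1 : FermionOp Λ') -
      ((μ : ℝ) : ℂ) • (nAt 0 hz 0 + nAt 0 hz 1 - ((n : ℝ) : ℂ) • (1 : FermionOp Λ')) =
    gramForm Λm O +
      (∑ k ∈ s, ((hubbardTTPrimeFermionInteraction t t' U).localHamiltonian Λ' * fermionEmbed (PolySite.incl hΛ) (B k) -
          fermionEmbed (PolySite.incl hΛ) (B k) * (hubbardTTPrimeFermionInteraction t t' U).localHamiltonian Λ') +
        ∑ l ∈ tt, (fermionEmbed (PolySite.incl (hsh l)) (fermionEmbed (PolySite.d4Emb (γ l) (wv l) Λ) (Y l)) -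
          fermionEmbed (PolySite.incl hΛ) (Y l)) +
        ∑ j ∈ u, b j • ladderWord (cw j) +
        ∑ r ∈ wp, ((spinPlus : FermionOp Λ') * Xp r - Xp r * (spinPlus : FermionOp Λ')) +
        ∑ r ∈ wm, ((spinMinus : FermionOp Λ') * Xm r - Xm r * (spinMinus : FermionOp Λ'))) +
      (∑ m' ∈ ah, ((dc m' : ℝ) : ℂ) • ((V m')ᴴ - V m') + ∑ k ∈ w, a k • ladderWord (word k))

/-- (Verbatim copy of `WardK.WardD4TorusCert`.) **W2 (target) — Ward × `D₄` window certificate ⇒ energy per site of every large `t–t'` torus**,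
read in the FULL `2n`-particle sector (all `S^z`), where `S^±` act. -/
def WardD4TorusCert : Prop :=
  ∀ (t t' U : ℝ) (L : ℕ) [NeZero L], 3 ≤ L →
  ∀ (nh : ℕ), nh ≤ Fintype.card (FermionTorus 2 L) →
  ∀ (n : ℝ) (Λ Λ' : Finset (Site 2)) (hΛ : Λ ⊆ Λ') (_h8 : thicken Λ 1 ⊆ Λ')
    (h0 : thicken ({0} : Finset (Site 2)) 1 ⊆ Λ') (hz : (0 : Site 2) ∈ Λ')
    (_hInj : Set.InjOn (Torus.proj (d := 2) L) ↑(thicken Λ' 1))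
    (μ : ℝ)
    (m : Type) (_ : Fintype m) (_ : DecidableEq m) (Λm : Matrix m m ℂ) (_hΛm : Λm.PosSemidef)
    (O : m → FermionOp Λ')
    (κ : Type) (s : Finset κ) (B : κ → FermionOp Λ)
    (ι : Type) (tt : Finset ι) (γ : ι → DihedralGroup 4) (wv : ι → Site 2)
    (hsh : ∀ l, d4ShiftSet (γ l) (wv l) Λ ⊆ Λ') (Y : ι → FermionOp Λ)
    (ρ : Type) (u : Finset ρ) (b : ρ → ℂ) (cw : ρ → List (Orb (PolySite Λ') × Bool))
    (_hcw : ∀ j ∈ u, ladderCharge (cw j) ≠ 0 ∨ ladderSpinCharge (cw j) ≠ 0)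
    (θ : Type) (wp : Finset θ) (Xp : θ → FermionOp Λ')
    (θ' : Type) (wm : Finset θ') (Xm : θ' → FermionOp Λ')
    (δ : Type) (ah : Finset δ) (dc : δ → ℝ) (V : δ → FermionOp Λ')
    (κ'' : Type) (w : Finset κ'') (a : κ'' → ℂ) (word : κ'' → List (Orb (PolySite Λ') × Bool))
    (c : ℝ),
    WardD4Identity t t' U n hΛ h0 hz μ Λm O s B tt γ wv hsh Y u b cw wp Xp wm Xm ah dc V w a word c →
    c - ∑ k ∈ w, ‖a k‖ + μ * ((((2 * nh : ℕ) : ℝ)) / (L : ℝ) ^ 2 - n) ≤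
      groundEnergy (hubbardTorusTT' L t t' U) (2 * nh) / (L : ℝ) ^ 2

/-- (Verbatim copy of `WardK.WardD4WindowSound`.) **W3 (target) — Ward × `D₄` window certificate ⇒ thermodynamic-limit energy density**
`c − Σₖ ‖aₖ‖ ≤ energyDensityTT' t t' U n` (`0 ≤ U`, `0 ≤ n < 2`, `thicken Λ 1 ⊆ Λ'`). With the two
Ward families empty and `μ_↑ = μ_↓` this is `energyDensityTT'_ge_of_window_certificate_d4`. -/
def WardD4WindowSound : Prop :=
  ∀ (t t' U : ℝ), 0 ≤ U → ∀ (n : ℝ), 0 ≤ n → n < 2 →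
  ∀ (Λ Λ' : Finset (Site 2)) (hΛ : Λ ⊆ Λ') (_h8 : thicken Λ 1 ⊆ Λ')
    (h0 : thicken ({0} : Finset (Site 2)) 1 ⊆ Λ') (hz : (0 : Site 2) ∈ Λ')
    (μ : ℝ)
    (m : Type) (_ : Fintype m) (_ : DecidableEq m) (Λm : Matrix m m ℂ) (_hΛm : Λm.PosSemidef)
    (O : m → FermionOp Λ')
    (κ : Type) (s : Finset κ) (B : κ → FermionOp Λ)
    (ι : Type) (tt : Finset ι) (γ : ι → DihedralGroup 4) (wv : ι → Site 2)
    (hsh : ∀ l, d4ShiftSet (γ l) (wv l) Λ ⊆ Λ') (Y : ι → FermionOp Λ)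
    (ρ : Type) (u : Finset ρ) (b : ρ → ℂ) (cw : ρ → List (Orb (PolySite Λ') × Bool))
    (_hcw : ∀ j ∈ u, ladderCharge (cw j) ≠ 0 ∨ ladderSpinCharge (cw j) ≠ 0)
    (θ : Type) (wp : Finset θ) (Xp : θ → FermionOp Λ')
    (θ' : Type) (wm : Finset θ') (Xm : θ' → FermionOp Λ')
    (δ : Type) (ah : Finset δ) (dc : δ → ℝ) (V : δ → FermionOp Λ')
    (κ'' : Type) (w : Finset κ'') (a : κ'' → ℂ) (word : κ'' → List (Orb (PolySite Λ') × Bool))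
    (c : ℝ),
    WardD4Identity t t' U n hΛ h0 hz μ Λm O s B tt γ wv hsh Y u b cw wp Xp wm Xm ah dc V w a word c →
    c - ∑ k ∈ w, ‖a k‖ ≤ energyDensityTT' t t' U n

/-! ### W1 of `wardk` PROVED: the generic-sector torus certificate theorem -/

/-- **`wardk`'s stub W1 holds**: `torus_minEnergyOn_div_ge_of_local_certificate`
(HubbardNNNHoppingWindowCertificate l.299) with the sector `szSector (2n) 0` replaced by an
arbitrary nonzero subspace `K` invariant under `A`, `U_v`, `U_vᴴ` — the tree proof verbatim with
its three uses of `szSector` turned into the hypotheses `hK`, `hKT`, `hKT'`.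
[cite: Han2020Bootstrap, §3] -/
theorem genericSectorTorusCert_holds : GenericSectorTorusCert := by
  intro d L _ A hA K hK hKA hKT hKT' hAT X hsum δ' dens μ ν g D G hD hGh hG m instF instD Λm hΛ O
    κ s Xc ι tt Us Y hU hUK hUK' hUU ρ r Q Z Z' q hQh hQ γ u C W hC hCK hCK' δ ah dc V κ'' w a M hM
    c hcert
  -- the objective with the density constraints folded in
  set X' := X - ∑ i ∈ dens, ((μ i : ℝ) : ℂ) • (D i - ((ν i : ℝ) : ℂ) • (1 : TOp d L)) with hX'
  have hcert' : X' - (c : ℂ) • (1 : TOp d L) =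
      gramForm Λm O +
        (∑ k ∈ s, (A * Xc k - Xc k * A) + ∑ l ∈ tt, (Us l * Y l * (Us l)ᴴ - Y l) +
          ∑ i ∈ r, (Z i * (Q i - ((q i : ℝ) : ℂ) • 1) + (Q i - ((q i : ℝ) : ℂ) • 1) * Z' i) +
          ∑ j ∈ u, (C j * W j - W j * C j)) +
        (∑ m' ∈ ah, ((dc m' : ℝ) : ℂ) • ((V m')ᴴ - V m') + ∑ k ∈ w, a k • M k) := by
    rw [hX', sub_right_comm]
    exact hcert
  have h := Matrix.re_projState_ge_of_local_certificate hA K hKA hK X' hΛ O s Xc tt Us Y hU hUK hUK'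
    hUU r Q Z Z' q hQh hQ u C W hC hCK hCK' ah dc V w a M hM hcert'
  -- evaluation of the objective and of the constraint observables in the tracial state
  set P := A.sectorGroundProj K with hP
  have hPh : P.IsHermitian := sectorGroundProj_isHermitian A K
  have hP2 : P * P = P := sectorGroundProj_mul_self A K
  have hP0 : P ≠ 0 := sectorGroundProj_ne_zero hA K hKA hK
  have hPA : P * A = ((A.minEnergyOn K : ℝ) : ℂ) • P := sectorGroundProj_mul hA K
  set ω := P.projState with hω
  have hone : ω 1 = 1 := projState_one hPh hP2 hP0
  have hPT : ∀ v : TorusSite d L, P * (fockTranslate v).val = (fockTranslate v).val * P := fun v =>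
    sectorGroundProj_commute hA K (hAT v) (fun ψ hψ => hKT v ψ hψ) (fun ψ hψ => hKT' v ψ hψ)
  have hTT : ∀ v : TorusSite d L, (fockTranslate v).valᴴ * (fockTranslate v).val = 1 :=
    fockTranslate_conjTranspose_mul_self
  have hωX : ω X = ((A.minEnergyOn K : ℝ) : ℂ) / (Fintype.card (TorusSite d L) : ℂ) :=
    projState_eq_div_of_sum_conj hPh hP2 hP0 hPA (fun v => (fockTranslate v).val) hPT hTT hsum
  have hωD : ∀ i ∈ dens, ω (D i) = ((g i : ℝ) : ℂ) / (Fintype.card (TorusSite d L) : ℂ) := by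
    intro i hi
    have hPG : P * G i = ((g i : ℝ) : ℂ) • P := by
      have h0 := sectorGroundProj_mul_sub_smul A K (hGh i hi) (hG i hi)
      rw [Matrix.mul_sub, Matrix.mul_smul, Matrix.mul_one, sub_eq_zero] at h0
      exact h0
    exact projState_eq_div_of_sum_conj hPh hP2 hP0 hPG (fun v => (fockTranslate v).val) hPT hTT (hD i hi)
  have hωX' : ω X' = ((A.minEnergyOn K : ℝ) : ℂ) / (Fintype.card (TorusSite d L) : ℂ) -
      ∑ i ∈ dens, ((μ i : ℝ) : ℂ) * (((g i : ℝ) : ℂ) / (Fintype.card (TorusSite d L) : ℂ) -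
        ((ν i : ℝ) : ℂ)) := by
    rw [hX', map_sub, map_sum, hωX]
    congr 1
    refine Finset.sum_congr rfl fun i hi => ?_
    rw [map_smul, map_sub, map_smul, hone, hωD i hi, smul_eq_mul, smul_eq_mul, mul_one]
  have hre : (ω X').re = A.minEnergyOn K / (L : ℝ) ^ d -
      ∑ i ∈ dens, μ i * (g i / (L : ℝ) ^ d - ν i) := by
    rw [hωX', card_torusSite]
    have e : ((A.minEnergyOn K : ℝ) : ℂ) / ((L ^ d : ℕ) : ℂ) -
        ∑ i ∈ dens, ((μ i : ℝ) : ℂ) * (((g i : ℝ) : ℂ) / ((L ^ d : ℕ) : ℂ) - ((ν i : ℝ) : ℂ)) =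
        ((A.minEnergyOn K / (L : ℝ) ^ d - ∑ i ∈ dens, μ i * (g i / (L : ℝ) ^ d - ν i) : ℝ) : ℂ) := by
      push_cast
      rfl
    rw [e, Complex.ofReal_re]
  rw [hre] at h
  linarith

/-! ### W2 of `wardk` PROVED: the torus-level Ward theorem on the `N`-particle sector -/

/-- **Ward transport for `S⁺`**: `S⁺_torus Γ'A − Γ'A S⁺_torus = Γ'(S⁺_{Λ} A − A S⁺_{Λ})` for every
window observable `A ∈ 𝔄_Λ` (the on-site terms `c†_{y↑}c_{y↓}` off the image are even and far from
`Γ'A`). [cite: BratteliRobinsonII1997, Thm. 6.2.4] -/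
theorem spinPlus_commutator_fermionEmbed_toTorusEmb {d : ℕ} (L : ℕ) [NeZero L] {Λ : Finset (Site d)}
    (h : Set.InjOn (Torus.proj (d := d) L) ↑Λ) (A : FermionOp Λ) :
    (spinPlus : TOp d L) * fermionEmbed (PolySite.toTorusEmb L h) A -
        fermionEmbed (PolySite.toTorusEmb L h) A * spinPlus =
      fermionEmbed (PolySite.toTorusEmb L h) ((spinPlus : FermionOp Λ) * A - A * spinPlus) :=
  sum_commutator_fermionEmbed_toTorusEmb L h A (fun a => creation (orb a 0) * annihilation (orb a 1))
    (fun p => creation (orb p 0) * annihilation (orb p 1))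
    (fun a => creation_mul_annihilation_mem_carEvenSubalgebra
      (orb_mem_orbs.2 (Finset.mem_singleton_self a)) (orb_mem_orbs.2 (Finset.mem_singleton_self a)))
    (fun p => by rw [fermionEmbed_mul, fermionEmbed_creation, fermionEmbed_annihilation])

/-- **Ward transport for `S⁻`**: `S⁻_torus Γ'A − Γ'A S⁻_torus = Γ'(S⁻_{Λ} A − A S⁻_{Λ})`.
[cite: BratteliRobinsonII1997, Thm. 6.2.4] -/
theorem spinMinus_commutator_fermionEmbed_toTorusEmb {d : ℕ} (L : ℕ) [NeZero L] {Λ : Finset (Site d)}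
    (h : Set.InjOn (Torus.proj (d := d) L) ↑Λ) (A : FermionOp Λ) :
    (spinMinus : TOp d L) * fermionEmbed (PolySite.toTorusEmb L h) A -
        fermionEmbed (PolySite.toTorusEmb L h) A * spinMinus =
      fermionEmbed (PolySite.toTorusEmb L h) ((spinMinus : FermionOp Λ) * A - A * spinMinus) := by
  rw [spinMinus_eq_sum, spinMinus_eq_sum]
  exact sum_commutator_fermionEmbed_toTorusEmb L h A (fun a => creation (orb a 1) * annihilation (orb a 0))
    (fun p => creation (orb p 1) * annihilation (orb p 0))
    (fun a => creation_mul_annihilation_mem_carEvenSubalgebra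
      (orb_mem_orbs.2 (Finset.mem_singleton_self a)) (orb_mem_orbs.2 (Finset.mem_singleton_self a)))
    (fun p => by rw [fermionEmbed_mul, fermionEmbed_creation, fermionEmbed_annihilation])

/-- **`wardk`'s stub W2 holds**: the generic-sector theorem at `K = nParticleSubmodule (2n)` of the
`t–t'` torus with the charges `S^±_torus`, `N̂`, `S^z` gives the torus-level Ward × `D₄` theorem —
the proof of `groundEnergy_hubbardTorusTT'_div_ge_of_window_certificate_d4` with the sector swapped,
ONE density observable `n_{0↑}+n_{0↓}` (translates sum to `N̂ = 2n` on `K`) and the two Ward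
families transported by `spinPlus/spinMinus_commutator_fermionEmbed_toTorusEmb`.
[cite: Han2020Bootstrap, §3] -/
theorem wardTorus_of_generic_holds : GenericSectorTorusCert → WardD4TorusCert := by
  intro hGen t t' U L _ hL nh hn n Λ Λ' hΛ h8 h0 hz hInj μ m instF instD Λm hΛm O κ s B ι tt γ wv hsh Y
    ρ u b cw hcw θ wp Xp θ' wm Xm δ ah dc V κ'' w a word c hcert
  -- the pull-back homomorphism and its restrictions
  have hInj' : Set.InjOn (Torus.proj (d := 2) L) ↑Λ' := hInj.mono (by exact_mod_cast subset_thicken Λ' 1)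
  have hInjΛ : Set.InjOn (Torus.proj (d := 2) L) ↑Λ := hInj'.mono (by exact_mod_cast hΛ)
  have hInj0 : Set.InjOn (Torus.proj (d := 2) L) ↑(thicken ({0} : Finset (Site 2)) 1) :=
    hInj'.mono (by exact_mod_cast h0)
  set Γ' := fermionEmbed (PolySite.toTorusEmb L hInj') with hΓ'
  set ΓΛ := fermionEmbed (PolySite.toTorusEmb L hInjΛ) with hΓΛ
  set H := hubbardTorusTT' L t t' U with hH
  set EΦ := (hubbardTTPrimeFermionInteraction t t' U).meanEnergyObs 1 with hEΦ
  -- the objective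
  set X := Γ' (fermionEmbed (PolySite.incl h0) EΦ) with hX
  have hX0 : X = fermionEmbed (PolySite.toTorusEmb L hInj0) EΦ := fermionEmbed_toTorusEmb_incl h0 hInj' EΦ
  have hsum : ∑ v' : TorusSite 2 L, (fockTranslate v').val * X * (fockTranslate v').valᴴ = H := by
    rw [hX0]
    have h := sum_relabel_translate_hubbardTTPrime_meanEnergyObs (L := L) t' t U hL
    simp_rw [relabel_eq_fockRelabel_conj] at h
    exact h
  -- the sector: all `2n`-particle states (every `S^z`)
  set K : Submodule ℂ (Fock (Orb (FermionTorus 2 L))) := nParticleSubmodule (2 * nh) with hKdef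
  have hmemK : ∀ ψ, ψ ∈ K ↔ IsNParticle (2 * nh) ψ := fun ψ => Iff.rfl
  have hK : K ≠ ⊥ := by
    obtain ⟨ψ, hψ, hψ0⟩ := (Submodule.ne_bot_iff _).1 (szSector_ne_bot (d := 2) (L := L) t U hn)
    exact (Submodule.ne_bot_iff _).2 ⟨ψ, (hmemK ψ).2 ((mem_szSector_iff _ _ ψ).1 hψ).1, hψ0⟩
  have hHN : Commute H totalNumber := hubbardTorusTT'_commute_totalNumber L t t' U
  have hKA : ∀ ψ ∈ K, H *ᵥ ψ ∈ K := fun ψ hψ =>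
    (hmemK _).2 (LiebTwo.isNParticle_mulVec_of_commute ((hmemK ψ).1 hψ) hHN.symm.eq)
  have hKT : ∀ v' : TorusSite 2 L, ∀ ψ ∈ K, (fockTranslate v').val *ᵥ ψ ∈ K := fun v' ψ hψ =>
    (hmemK _).2 (((hmemK ψ).1 hψ).fockRelabel_mulVec _)
  have hKT' : ∀ v' : TorusSite 2 L, ∀ ψ ∈ K, (fockTranslate v').valᴴ *ᵥ ψ ∈ K := fun v' ψ hψ => by
    rw [fockTranslate_val_conjTranspose]; exact hKT (-v') ψ hψ
  have hA : H.IsHermitian := hubbardTorusTT'_isHermitian L t t' U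
  have hAT : ∀ v' : TorusSite 2 L, (fockTranslate v').val * H = H * (fockTranslate v').val := fun v' =>
    (fockTranslate_commute_hubbardTorusTT' L v' t t' U).eq
  -- density observable: total site density at the origin; its translates sum to `N̂ = 2n` on `K`
  set D₀ : TOp 2 L := numberOp (FermionTorus.ofTorusSite (0 : TorusSite 2 L)) 0 +
    numberOp (FermionTorus.ofTorusSite (0 : TorusSite 2 L)) 1 with hD₀
  have hDΓ : Γ' (nAt 0 hz 0 + nAt 0 hz 1) = D₀ := by
    rw [map_add, hΓ', fermionEmbed_toTorusEmb_nAt_zero hz hInj' 0, fermionEmbed_toTorusEmb_nAt_zero hz hInj' 1]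
  have hDsum : ∀ i ∈ (Finset.univ : Finset (Fin 1)),
      ∑ v' : TorusSite 2 L, (fockTranslate v').val * ((fun _ : Fin 1 => D₀) i) * (fockTranslate v').valᴴ =
        (fun _ : Fin 1 => (totalNumber : TOp 2 L)) i := by
    intro _ _
    simp only [hD₀, Matrix.mul_add, Matrix.add_mul, Finset.sum_add_distrib, sum_conj_fockTranslate_numberOp]
    exact (totalNumber_eq_sum_spin_sum (L := L)).symm
  have hGh : ∀ i ∈ (Finset.univ : Finset (Fin 1)), ((fun _ : Fin 1 => (totalNumber : TOp 2 L)) i).IsHermitian := by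
    intro _ _
    show (totalNumber : TOp 2 L)ᴴ = totalNumber
    rw [totalNumber_eq_numberDiag_univ]; exact numberDiag_conjTranspose _
  have hGs : ∀ i ∈ (Finset.univ : Finset (Fin 1)), ∀ ψ ∈ K,
      (fun _ : Fin 1 => (totalNumber : TOp 2 L)) i *ᵥ ψ = ((((fun _ : Fin 1 => ((2 * nh : ℕ) : ℝ)) i : ℝ) : ℝ) : ℂ) • ψ := by
    intro _ _ ψ hψ
    show (totalNumber : TOp 2 L) *ᵥ ψ = _
    rw [totalNumber_mulVec_of_isNParticle ((hmemK ψ).1 hψ)]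
    push_cast; rfl
  -- symmetry family: affine `D₄` maps
  set Us : ι → TOp 2 L := fun l => (fockTranslate (Torus.proj L (wv l))).val * (fockD4 (L := L) (γ l)).val with hUs
  set Yt : ι → TOp 2 L := fun l => ΓΛ (Y l) with hYt
  have hU : ∀ l ∈ tt, Us l * H = H * Us l := fun l _ => d4Affine_mul_hubbardTorusTT' _ _ t t' U
  have hUK : ∀ l ∈ tt, ∀ ψ ∈ K, Us l *ᵥ ψ ∈ K := fun l _ ψ hψ => by
    show ((fockTranslate (Torus.proj L (wv l))).val * (fockD4 (L := L) (γ l)).val) *ᵥ ψ ∈ K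
    rw [← mulVec_mulVec]
    exact (hmemK _).2 ((((hmemK ψ).1 hψ).fockRelabel_mulVec _).fockRelabel_mulVec _)
  have hUK' : ∀ l ∈ tt, ∀ ψ ∈ K, (Us l)ᴴ *ᵥ ψ ∈ K := fun l _ ψ hψ => by
    show ((fockTranslate (Torus.proj L (wv l))).val * (fockD4 (L := L) (γ l)).val)ᴴ *ᵥ ψ ∈ K
    rw [conjTranspose_mul, fockD4_val_conjTranspose, fockTranslate_val_conjTranspose, ← mulVec_mulVec]
    exact (hmemK _).2 ((((hmemK ψ).1 hψ).fockRelabel_mulVec _).fockRelabel_mulVec _)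
  have hUU : ∀ l ∈ tt, (Us l)ᴴ * Us l = 1 := fun l _ => d4Affine_conjTranspose_mul_self _ _
  -- charge family: `U(1)×U(1)`-charged words as commutators with `N̂` / `S^z`, and the Ward families
  set emb : Orb (PolySite Λ') × Bool → Orb (FermionTorus 2 L) × Bool :=
    fun p => (Orb.embMap (PolySite.toTorusEmb L hInj') p.1, p.2) with hemb
  set C₁ : ρ → TOp 2 L :=
    fun j => if ladderCharge ((cw j).map emb) ≠ 0 then totalNumber else HubbardWave0.spinZ with hC₁
  set W₁ : ρ → TOp 2 L :=
    fun j => (b j / (if ladderCharge ((cw j).map emb) ≠ 0 then ((ladderCharge ((cw j).map emb) : ℤ) : ℂ)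
      else ((ladderSpinCharge ((cw j).map emb) : ℤ) : ℂ) / 2)) • ladderWord ((cw j).map emb) with hW₁
  set C : ρ ⊕ (θ ⊕ θ') → TOp 2 L :=
    Sum.elim C₁ (Sum.elim (fun _ => (spinPlus : TOp 2 L)) (fun _ => (spinMinus : TOp 2 L))) with hC
  set W : ρ ⊕ (θ ⊕ θ') → TOp 2 L :=
    Sum.elim W₁ (Sum.elim (fun r => Γ' (Xp r)) (fun r => Γ' (Xm r))) with hW
  set uu : Finset (ρ ⊕ (θ ⊕ θ')) := u.disjSum (wp.disjSum wm) with huu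
  have hHS : Commute H HubbardWave0.spinZ := hubbardTorusTT'_commute_spinZ L t t' U
  have hHp : Commute H spinPlus :=
    LiebTwoHoppings.hamiltonian₂_commute_spinPlus (fermionTorusGraph 2 L) (fermionTorusDiagGraph L) t t' U
  have hHm : Commute H spinMinus :=
    LiebTwoHoppings.hamiltonian₂_commute_spinMinus (fermionTorusGraph 2 L) (fermionTorusDiagGraph L) t t' U
  have hC₁H : ∀ j, C₁ j * H = H * C₁ j := by
    intro j
    by_cases hq : ladderCharge ((cw j).map emb) ≠ 0
    · simp only [hC₁, hq, ne_eq, not_false_eq_true, if_true]; exact hHN.symm.eq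
    · simp only [hC₁, hq, if_false]; exact hHS.symm.eq
  have hC₁K : ∀ j, ∀ ψ ∈ K, C₁ j *ᵥ ψ ∈ K := by
    intro j ψ hψ
    have hNψ := (hmemK ψ).1 hψ
    by_cases hq : ladderCharge ((cw j).map emb) ≠ 0
    · simp only [hC₁, hq, ne_eq, not_false_eq_true, if_true]
      rw [totalNumber_mulVec_of_isNParticle hNψ]
      exact Submodule.smul_mem _ _ hψ
    · simp only [hC₁, hq, if_false]
      exact (hmemK _).2 (LiebTwo.isNParticle_mulVec_of_commute hNψ LiebTwo.totalNumber_mul_spinZ)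
  have hC₁h : ∀ j, (C₁ j)ᴴ = C₁ j := by
    intro j
    by_cases hq : ladderCharge ((cw j).map emb) ≠ 0
    · simp only [hC₁, hq, ne_eq, not_false_eq_true, if_true]
      rw [totalNumber_eq_numberDiag_univ]
      exact numberDiag_conjTranspose _
    · simp only [hC₁, hq, if_false]; exact HubbardWave0.spinZ_isHermitian.eq
  have hpK : ∀ ψ ∈ K, (spinPlus : TOp 2 L) *ᵥ ψ ∈ K := fun ψ hψ =>
    (hmemK _).2 (LiebTwo.isNParticle_mulVec_of_commute ((hmemK ψ).1 hψ) LiebTwo.totalNumber_mul_spinPlus)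
  have hmK : ∀ ψ ∈ K, (spinMinus : TOp 2 L) *ᵥ ψ ∈ K := fun ψ hψ =>
    (hmemK _).2 (LiebTwo.isNParticle_mulVec_of_commute ((hmemK ψ).1 hψ) LiebTwo.totalNumber_mul_spinMinus)
  have hCH : ∀ j ∈ uu, C j * H = H * C j := by
    rintro (j | j | j) _
    · exact hC₁H j
    · exact hHp.symm.eq
    · exact hHm.symm.eq
  have hCK : ∀ j ∈ uu, ∀ ψ ∈ K, C j *ᵥ ψ ∈ K := by
    rintro (j | j | j) _ ψ hψ
    · exact hC₁K j ψ hψ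
    · exact hpK ψ hψ
    · exact hmK ψ hψ
  have hCK' : ∀ j ∈ uu, ∀ ψ ∈ K, (C j)ᴴ *ᵥ ψ ∈ K := by
    rintro (j | j | j) _ ψ hψ
    · show (C₁ j)ᴴ *ᵥ ψ ∈ K
      rw [hC₁h j]; exact hC₁K j ψ hψ
    · show (spinPlus : TOp 2 L)ᴴ *ᵥ ψ ∈ K
      exact hmK ψ hψ
    · show (spinMinus : TOp 2 L)ᴴ *ᵥ ψ ∈ K
      rw [show (spinMinus : TOp 2 L)ᴴ = spinPlus from conjTranspose_conjTranspose _]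
      exact hpK ψ hψ
  have hcharged : ∀ j ∈ u, Γ' (b j • ladderWord (cw j)) = C₁ j * W₁ j - W₁ j * C₁ j := by
    intro j hj
    rw [map_smul, hΓ', fermionEmbed_ladderWord]
    have hl : ladderCharge ((cw j).map emb) ≠ 0 ∨ ladderSpinCharge ((cw j).map emb) ≠ 0 := by
      rw [hemb, ladderCharge_map_embMap, ladderSpinCharge_map_embMap]; exact hcw j hj
    exact smul_ladderWord_eq_commutator_of_charged (b j) _ hl
  -- residual words
  set Mw : κ'' → TOp 2 L := fun k => ladderWord ((word k).map emb) with hMw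
  have hMc : ∀ k ∈ w, (Mw k).IsContraction := fun k _ => by
    rw [hMw]; dsimp only; rw [ladderWord_eq_prod]; exact isContraction_prod_ladder _
  -- the identity, pulled back into the torus
  have htorus : X - (c : ℂ) • (1 : TOp 2 L) -
      ∑ i ∈ (Finset.univ : Finset (Fin 1)), (((fun _ : Fin 1 => μ) i : ℝ) : ℂ) •
        ((fun _ : Fin 1 => D₀) i - (((fun _ : Fin 1 => n) i : ℝ) : ℂ) • (1 : TOp 2 L)) =
      gramForm Λm (fun i => Γ' (O i)) +
        (∑ k ∈ s, (H * Γ' (fermionEmbed (PolySite.incl hΛ) (B k)) - Γ' (fermionEmbed (PolySite.incl hΛ) (B k)) * H) +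
          ∑ l ∈ tt, (Us l * Yt l * (Us l)ᴴ - Yt l) +
          ∑ i ∈ (∅ : Finset (Fin 0)), ((0 : TOp 2 L) * ((0 : TOp 2 L) - (((0 : ℝ) : ℝ) : ℂ) • 1) +
            ((0 : TOp 2 L) - (((0 : ℝ) : ℝ) : ℂ) • 1) * (0 : TOp 2 L)) +
          ∑ j ∈ uu, (C j * W j - W j * C j)) +
        (∑ m' ∈ ah, ((dc m' : ℝ) : ℂ) • ((Γ' (V m'))ᴴ - Γ' (V m')) + ∑ k ∈ w, a k • Mw k) := by
    have key := congrArg Γ' hcert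
    -- left-hand side
    rw [map_sub, map_sub, map_smul, map_one, map_smul, map_sub, map_smul, map_one, hDΓ] at key
    have hlhs : ∑ i ∈ (Finset.univ : Finset (Fin 1)), (((fun _ : Fin 1 => μ) i : ℝ) : ℂ) •
        ((fun _ : Fin 1 => D₀) i - (((fun _ : Fin 1 => n) i : ℝ) : ℂ) • (1 : TOp 2 L)) =
        ((μ : ℝ) : ℂ) • (D₀ - ((n : ℝ) : ℂ) • (1 : TOp 2 L)) := Fin.sum_univ_one _
    rw [hlhs]
    -- right-hand side, family by family
    have h1 : Γ' (∑ k ∈ s, ((hubbardTTPrimeFermionInteraction t t' U).localHamiltonian Λ' * fermionEmbed (PolySite.incl hΛ) (B k) -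
        fermionEmbed (PolySite.incl hΛ) (B k) * (hubbardTTPrimeFermionInteraction t t' U).localHamiltonian Λ')) =
        ∑ k ∈ s, (H * Γ' (fermionEmbed (PolySite.incl hΛ) (B k)) - Γ' (fermionEmbed (PolySite.incl hΛ) (B k)) * H) := by
      rw [map_sum]
      refine Finset.sum_congr rfl fun k _ => ?_
      rw [hH, hΓ', hubbardTorusTT'_commutator_fermionEmbed L t t' U hΛ h8 hInj (B k)]
    have h2 : Γ' (∑ l ∈ tt, (fermionEmbed (PolySite.incl (hsh l)) (fermionEmbed (PolySite.d4Emb (γ l) (wv l) Λ) (Y l)) -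
        fermionEmbed (PolySite.incl hΛ) (Y l))) = ∑ l ∈ tt, (Us l * Yt l * (Us l)ᴴ - Yt l) := by
      rw [map_sum]
      refine Finset.sum_congr rfl fun l _ => ?_
      rw [hUs, hYt, hΓΛ, hΓ']
      exact fermionEmbed_toTorusEmb_d4_sub hΛ (γ l) (wv l) (hsh l) hInj' (Y l)
    have h3 : Γ' (∑ j ∈ u, b j • ladderWord (cw j)) = ∑ j ∈ u, (C₁ j * W₁ j - W₁ j * C₁ j) := by
      rw [map_sum]
      exact Finset.sum_congr rfl hcharged
    have h3p : Γ' (∑ r ∈ wp, ((spinPlus : FermionOp Λ') * Xp r - Xp r * (spinPlus : FermionOp Λ'))) =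
        ∑ r ∈ wp, ((spinPlus : TOp 2 L) * Γ' (Xp r) - Γ' (Xp r) * spinPlus) := by
      rw [map_sum]
      refine Finset.sum_congr rfl fun r _ => ?_
      rw [hΓ', spinPlus_commutator_fermionEmbed_toTorusEmb L hInj' (Xp r)]
    have h3m : Γ' (∑ r ∈ wm, ((spinMinus : FermionOp Λ') * Xm r - Xm r * (spinMinus : FermionOp Λ'))) =
        ∑ r ∈ wm, ((spinMinus : TOp 2 L) * Γ' (Xm r) - Γ' (Xm r) * spinMinus) := by
      rw [map_sum]
      refine Finset.sum_congr rfl fun r _ => ?_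
      rw [hΓ', spinMinus_commutator_fermionEmbed_toTorusEmb L hInj' (Xm r)]
    have h4 : Γ' (∑ m' ∈ ah, ((dc m' : ℝ) : ℂ) • ((V m')ᴴ - V m')) =
        ∑ m' ∈ ah, ((dc m' : ℝ) : ℂ) • ((Γ' (V m'))ᴴ - Γ' (V m')) := by
      rw [map_sum]
      refine Finset.sum_congr rfl fun m' _ => ?_
      rw [map_smul, map_sub, hΓ', fermionEmbed_conjTranspose]
    have h5 : Γ' (∑ k ∈ w, a k • ladderWord (word k)) = ∑ k ∈ w, a k • Mw k := by
      rw [map_sum]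
      refine Finset.sum_congr rfl fun k _ => ?_
      rw [map_smul, hMw, hΓ', fermionEmbed_ladderWord]
    have huC : ∑ j ∈ uu, (C j * W j - W j * C j) =
        ∑ j ∈ u, (C₁ j * W₁ j - W₁ j * C₁ j) +
          (∑ r ∈ wp, ((spinPlus : TOp 2 L) * Γ' (Xp r) - Γ' (Xp r) * spinPlus) +
            ∑ r ∈ wm, ((spinMinus : TOp 2 L) * Γ' (Xm r) - Γ' (Xm r) * spinMinus)) := by
      rw [huu, Finset.sum_disjSum, Finset.sum_disjSum]
      rfl
    rw [hX, key, map_add, map_add, map_add, map_add, map_add, map_add, map_add, hΓ', fermionEmbed_gramForm,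
      ← hΓ', h1, h2, h3, h3p, h3m, h4, h5, Finset.sum_empty, add_zero, huC]
    abel
  -- apply the generic-sector theorem on `K`
  have hmain := hGen 2 L H hA K hK hKA hKT hKT' hAT X hsum (Fin 1) Finset.univ (fun _ => μ) (fun _ => n)
    (fun _ => ((2 * nh : ℕ) : ℝ)) (fun _ => D₀) (fun _ => totalNumber) hDsum hGh hGs m instF instD Λm hΛm
    (fun i => Γ' (O i)) κ s (fun k => Γ' (fermionEmbed (PolySite.incl hΛ) (B k))) ι tt Us Yt hU hUK hUK' hUU
    (Fin 0) (∅ : Finset (Fin 0)) (fun _ => 0) (fun _ => 0) (fun _ => 0) (fun _ => 0)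
    (fun i hi => absurd hi (Finset.notMem_empty i)) (fun i hi => absurd hi (Finset.notMem_empty i))
    (ρ ⊕ (θ ⊕ θ')) uu C W hCH hCK hCK' δ ah dc (fun m' => Γ' (V m')) κ'' w a Mw hMc c htorus
  rw [Fin.sum_univ_one, ← groundEnergy_eq_minEnergyOn H (2 * nh) K hmemK] at hmain
  exact hmain

/-! ### W3 of `wardk` PROVED: the thermodynamic limit -/

/-- **`wardk`'s stub W3 holds**: the torus-level Ward theorem implies the thermodynamic-limit
soundness statement, by the 30-line limit of `energyDensityTT'_ge_of_window_certificate_d4`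
(`exists_forall_le_injOn_proj`, `energyDensityTT'_ge_of_eventually_ge_torus`, `rectN n L = 2⌊nL²/2⌋₊`).
[cite: Han2020Bootstrap, §3] -/
theorem wardTL_of_torus_holds : WardD4TorusCert → WardD4WindowSound := by
  intro hT t t' U hU n hn0 hn2 Λ Λ' hΛ h8 h0 hz μ m instF instD Λm hΛm O κ s B ι tt γ wv hsh Y ρ u b
    cw hcw θ wp Xp θ' wm Xm δ ah dc V κ'' w a word c hcert
  obtain ⟨L₀, hL₀⟩ := exists_forall_le_injOn_proj (thicken Λ' 1)
  refine energyDensityTT'_ge_of_eventually_ge_torus t t' hU hn0 hn2 (μ := μ) ?_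
  filter_upwards [Filter.eventually_ge_atTop (max L₀ 3)] with L hL
  have hL3 : 3 ≤ L := le_trans (le_max_right _ _) hL
  have hLL : L₀ ≤ L := le_trans (le_max_left _ _) hL
  haveI : NeZero L := ⟨by omega⟩
  set nh : ℕ := ⌊n * (L : ℝ) ^ 2 / 2⌋₊ with hnh
  have hrect : rectN n L = 2 * nh := rfl
  have hn : nh ≤ Fintype.card (FermionTorus 2 L) := by
    have h := rectN_le_two_mul hn0 hn2.le L
    rw [hrect] at h
    have hcard : Fintype.card (FermionTorus 2 L) = L ^ 2 := by simp [FermionTorus]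
    rw [hcard, sq]
    omega
  have hmain := hT t t' U L hL3 nh hn n Λ Λ' hΛ h8 h0 hz (hL₀ L hLL) μ m instF instD Λm hΛm O κ s B
    ι tt γ wv hsh Y ρ u b cw hcw θ wp Xp θ' wm Xm δ ah dc V κ'' w a word c hcert
  rw [hrect]
  exact hmain

/-! ### The whole soundness layer of the Ward × `D₄` window format, assembled (no sorry) -/

/-- **SU(2)-Ward × affine-`D₄` window certificates are sound** (`wardk`'s W3 ∘ W2 ∘ W1, all proved
above): the window identity `WardD4Identity t t' U n …` with `Λm ⪰ 0` gives
`c − Σₖ ‖aₖ‖ ≤ energyDensityTT' t t' U n` (`0 ≤ U`, `0 ≤ n < 2`). [cite: Han2020Bootstrap, §3] -/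
theorem wardD4WindowSound_holds : WardD4WindowSound :=
  wardTL_of_torus_holds (wardTorus_of_generic_holds genericSectorTorusCert_holds)

/-! ### Replay glue: adjoint ladder words (for PSD-slack absorption into the residual slot) -/

section Ladder

variable {ι : Type} [LinearOrder ι] [Fintype ι]

omit [Fintype ι] in
/-- The adjoint letter. [folklore] -/
theorem ladderLetter_conjTranspose (p : ι × Bool) :
    (ladderLetter p)ᴴ = ladderLetter (p.1, !p.2) := by
  rcases p with ⟨i, _ | _⟩
  · simp [ladderLetter, annihilation_conjTranspose]
  · simp [ladderLetter, creation_conjTranspose]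

/-- `ladderWord (l₁ ++ l₂) = ladderWord l₁ * ladderWord l₂`. [folklore] -/
theorem ladderWord_append (l₁ l₂ : List (ι × Bool)) :
    ladderWord (l₁ ++ l₂) = ladderWord l₁ * ladderWord l₂ := by
  unfold ladderWord
  rw [List.map_append, List.prod_append]

/-- **The adjoint of a ladder word is the reversed daggered word.** [folklore] -/
theorem ladderWord_conjTranspose (l : List (ι × Bool)) :
    (ladderWord l)ᴴ = ladderWord ((l.map fun p => (p.1, !p.2)).reverse) := by
  induction l with
  | nil => simp
  | cons p l ih =>
      rw [ladderWord_cons, conjTranspose_mul, ih, ladderLetter_conjTranspose, List.map_cons,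
        List.reverse_cons, ladderWord_append, ladderWord_cons, ladderWord_nil, Matrix.mul_one]

/-- `wᴴ w` is the ladder word `w† ++ w` (hence a contraction, admissible in the residual slot).
[folklore] -/
theorem conjTranspose_mul_ladderWord_eq (l : List (ι × Bool)) :
    (ladderWord l)ᴴ * ladderWord l = ladderWord ((l.map fun p => (p.1, !p.2)).reverse ++ l) := by
  rw [ladderWord_append, ladderWord_conjTranspose]

end Ladder

/-! ### Registered stubs of the line `dualreplay` -/

/-- **G1 (stub, size S–M; matrix analysis) — PSD restoration from an approximate Gram factor.**
If `Λ` is Hermitian and `E = Λ − L Lᴴ` has all absolute row sums `≤ g` (a RECTANGULAR factor `L`: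
low-rank first-order iterates are allowed), then `Λ + g·1 ⪰ 0`.  Proof route: `Λ + g·1 =
L Lᴴ + (E + g·1)`, `L Lᴴ ⪰ 0` (`Matrix.posSemidef_self_mul_conjTranspose`) and the Hermitian
`E + g·1` is PSD by the quadratic-form Gershgorin bound `|x* E x| ≤ Σᵢⱼ |Eᵢⱼ| |xᵢ| |xⱼ| ≤ g ‖x‖²`
(column sums = row sums by Hermiticity).  This replaces an exact `LDLᵀ` of a rounded dual block by a
float Cholesky factor rounded to `ℚ` plus ONE row-sum inequality — the kernel-replay form of the
lb-dual "interval PSD slack". [cite: Han2020Bootstrap, §3] -/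
def PsdOfFactorRowsum : Prop :=
  ∀ (k r : ℕ) (Λm : Matrix (Fin k) (Fin k) ℂ) (_hΛ : Λm.IsHermitian) (Lc : Matrix (Fin k) (Fin r) ℂ) (g : ℝ)
    (_hg : ∀ i, ∑ j, ‖(Λm - Lc * Lcᴴ) i j‖ ≤ g),
    (Λm + ((g : ℝ) : ℂ) • (1 : Matrix (Fin k) (Fin k) ℂ)).PosSemidef

/-- Quadratic-form Geršgorin: a Hermitian matrix whose absolute row sums are `≤ g` satisfies
`|x† E x| ≤ g ‖x‖²`. [folklore; Horn–Johnson Cor. 7.2.3] -/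
theorem norm_quadForm_le_of_rowsum {k : ℕ} {E : Matrix (Fin k) (Fin k) ℂ} (hEh : E.IsHermitian)
    {g : ℝ} (hg : ∀ i, ∑ j, ‖E i j‖ ≤ g) (x : Fin k → ℂ) :
    ‖star x ⬝ᵥ E *ᵥ x‖ ≤ g * ∑ i, ‖x i‖ ^ 2 := by
  have hsym : ∀ i j, ‖E i j‖ = ‖E j i‖ := fun i j => by
    rw [← hEh.apply i j, norm_star]
  have hcol : ∀ j, ∑ i, ‖E i j‖ ≤ g := fun j => by
    calc ∑ i, ‖E i j‖ = ∑ i, ‖E j i‖ := Finset.sum_congr rfl fun i _ => hsym i j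
      _ ≤ g := hg j
  have hT1 : ‖star x ⬝ᵥ E *ᵥ x‖ ≤ ∑ i, ∑ j, ‖E i j‖ * (‖x i‖ * ‖x j‖) := by
    simp only [dotProduct, Matrix.mulVec, Pi.star_apply]
    refine (norm_sum_le _ _).trans (Finset.sum_le_sum fun i _ => ?_)
    rw [norm_mul, norm_star]
    calc ‖x i‖ * ‖∑ j, E i j * x j‖ ≤ ‖x i‖ * ∑ j, ‖E i j * x j‖ := by
          gcongr; exact norm_sum_le _ _
      _ = ∑ j, ‖E i j‖ * (‖x i‖ * ‖x j‖) := by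
          rw [Finset.mul_sum]; exact Finset.sum_congr rfl fun j _ => by rw [norm_mul]; ring
  have hA : ∑ i, ∑ j, ‖E i j‖ * ‖x i‖ ^ 2 ≤ g * ∑ i, ‖x i‖ ^ 2 := by
    rw [Finset.mul_sum]
    refine Finset.sum_le_sum fun i _ => ?_
    rw [← Finset.sum_mul]
    exact mul_le_mul_of_nonneg_right (hg i) (sq_nonneg _)
  have hB : ∑ i, ∑ j, ‖E i j‖ * ‖x j‖ ^ 2 ≤ g * ∑ j, ‖x j‖ ^ 2 := by
    rw [Finset.sum_comm, Finset.mul_sum]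
    refine Finset.sum_le_sum fun j _ => ?_
    rw [← Finset.sum_mul]
    exact mul_le_mul_of_nonneg_right (hcol j) (sq_nonneg _)
  have hpt : ∀ i j, ‖E i j‖ * (‖x i‖ * ‖x j‖) ≤
      (‖E i j‖ * ‖x i‖ ^ 2 + ‖E i j‖ * ‖x j‖ ^ 2) / 2 := by
    intro i j
    have h2 := two_mul_le_add_sq ‖x i‖ ‖x j‖
    have h0 := norm_nonneg (E i j)
    nlinarith
  calc ‖star x ⬝ᵥ E *ᵥ x‖ ≤ ∑ i, ∑ j, ‖E i j‖ * (‖x i‖ * ‖x j‖) := hT1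
    _ ≤ ∑ i, ∑ j, (‖E i j‖ * ‖x i‖ ^ 2 + ‖E i j‖ * ‖x j‖ ^ 2) / 2 :=
        Finset.sum_le_sum fun i _ => Finset.sum_le_sum fun j _ => hpt i j
    _ = ((∑ i, ∑ j, ‖E i j‖ * ‖x i‖ ^ 2) + ∑ i, ∑ j, ‖E i j‖ * ‖x j‖ ^ 2) / 2 := by
        simp only [add_div, Finset.sum_add_distrib, Finset.sum_div]
    _ ≤ g * ∑ i, ‖x i‖ ^ 2 := by linarith

/-- **G1 PROVED** (2026-08-28, this seat): PSD from an approximate (rectangular) factor and ONE row-sum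
bound — `Λ + g·1 = L·Lᴴ + (E + g·1)` with `E` Hermitian of absolute row sums `≤ g`, and the second
summand is PSD by quadratic-form Geršgorin.  Real-symmetric analogue in the tree:
`Literature.Algebra.Polynomial.SosProgramSimplification.posSemidef_add_of_sub_smul_one` [Lofberg2009 Thm 4].
[folklore; Horn–Johnson Cor. 7.2.3] -/
theorem psdOfFactorRowsum_holds : PsdOfFactorRowsum := by
  intro k r Λm hΛ Lc g hg
  set E : Matrix (Fin k) (Fin k) ℂ := Λm - Lc * Lcᴴ with hE
  have hEh : E.IsHermitian := hΛ.sub (Matrix.isHermitian_mul_conjTranspose_self Lc)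
  have h1h : (((g : ℝ) : ℂ) • (1 : Matrix (Fin k) (Fin k) ℂ)).IsHermitian := by
    unfold Matrix.IsHermitian
    rw [Matrix.conjTranspose_smul, Matrix.conjTranspose_one, Complex.star_def, Complex.conj_ofReal]
  have hHerm : (E + ((g : ℝ) : ℂ) • (1 : Matrix (Fin k) (Fin k) ℂ)).IsHermitian := hEh.add h1h
  have hsplit : Λm + ((g : ℝ) : ℂ) • (1 : Matrix (Fin k) (Fin k) ℂ) =
      Lc * Lcᴴ + (E + ((g : ℝ) : ℂ) • (1 : Matrix (Fin k) (Fin k) ℂ)) := by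
    rw [hE]; abel
  rw [hsplit]
  refine (Matrix.posSemidef_self_mul_conjTranspose Lc).add ?_
  refine Matrix.PosSemidef.of_dotProduct_mulVec_nonneg hHerm fun x => ?_
  have hq := norm_quadForm_le_of_rowsum hEh hg x
  -- the quadratic form of a Hermitian matrix is real
  have hreal : star (star x ⬝ᵥ (E + ((g : ℝ) : ℂ) • (1 : Matrix (Fin k) (Fin k) ℂ)) *ᵥ x) =
      star x ⬝ᵥ (E + ((g : ℝ) : ℂ) • (1 : Matrix (Fin k) (Fin k) ℂ)) *ᵥ x := by
    conv_lhs => rw [Matrix.star_dotProduct, star_star, Matrix.star_mulVec, hHerm.eq,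
      ← Matrix.dotProduct_mulVec]
  have him : (star x ⬝ᵥ (E + ((g : ℝ) : ℂ) • (1 : Matrix (Fin k) (Fin k) ℂ)) *ᵥ x).im = 0 :=
    Complex.conj_eq_iff_im.1 hreal
  -- value split
  have hexp : star x ⬝ᵥ (E + ((g : ℝ) : ℂ) • (1 : Matrix (Fin k) (Fin k) ℂ)) *ᵥ x =
      star x ⬝ᵥ E *ᵥ x + ((g : ℝ) : ℂ) * (((∑ i, ‖x i‖ ^ 2 : ℝ)) : ℂ) := by
    rw [Matrix.add_mulVec, Matrix.smul_mulVec, Matrix.one_mulVec, dotProduct_add,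
      dotProduct_smul, smul_eq_mul]
    congr 2
    push_cast
    simp only [dotProduct, Pi.star_apply, Complex.star_def, Complex.conj_mul']
  rw [Complex.nonneg_iff]
  refine ⟨?_, him.symm⟩
  rw [hexp, Complex.add_re, Complex.re_ofReal_mul, Complex.ofReal_re]
  have hre := (abs_le.1 (Complex.abs_re_le_norm (star x ⬝ᵥ E *ᵥ x))).1
  linarith

/-- Registered stub G1 — now CLOSED by `psdOfFactorRowsum_holds` (kept under its registered name so the
skeleton registry and `LowerEdge…_of` are unchanged). -/
theorem stub_psdOfFactorRowsum : PsdOfFactorRowsum := psdOfFactorRowsum_holds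

/-- **G3 (stub, size XL; the computational crux in FIRST-ORDER-REPLAY NORMAL FORM) — a Ward × `D₄`
window certificate at `(t,t',U,n) = (1,0,8,7/8)` whose Gram matrix is given by an APPROXIMATE FACTOR
with row-sum defect `g`, of value `≥ −4/5 + g·(#Gram words)`, exists.**  All index sets are finite
ordinals; the Gram operators are ladder words `ow i` (so that the slack words `(ow i)† ++ ow i` are
again ladder words); `Λm` is only required HERMITIAN (exactly checkable on rational data) — its
positivity up to `g` is CERTIFIED by `(Lc, g)`, not assumed; every other inexactness of a first-order
/ rounded dual (identity defect, Ward-row defect) is already absorbed by the format's residual words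
`a k • ladderWord (word k)` at cost `Σ‖aₖ‖`, so no further slot is needed.  Record: MENU #529 certifies
−0.8295699476 (+0.0296 short of −4/5); CAP census: footprint ≥ (5,5) words are necessary.
[cite: Han2020Bootstrap, §3] -/
def FoReplayCert_m4o5 : Prop :=
  ∃ (Λ Λ' : Finset (Site 2)) (hΛ : Λ ⊆ Λ') (_h8 : thicken Λ 1 ⊆ Λ')
    (h0 : thicken ({0} : Finset (Site 2)) 1 ⊆ Λ') (hz : (0 : Site 2) ∈ Λ')
    (μ : ℝ)
    (nm : ℕ) (Λm : Matrix (Fin nm) (Fin nm) ℂ) (_hΛh : Λm.IsHermitian)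
    (nr : ℕ) (Lc : Matrix (Fin nm) (Fin nr) ℂ) (g : ℝ) (_hg0 : 0 ≤ g)
    (_hg : ∀ i, ∑ j, ‖(Λm - Lc * Lcᴴ) i j‖ ≤ g)
    (ow : Fin nm → List (Orb (PolySite Λ') × Bool))
    (ns : ℕ) (B : Fin ns → FermionOp Λ)
    (nt : ℕ) (γ : Fin nt → DihedralGroup 4) (wv : Fin nt → Site 2)
    (hsh : ∀ l, d4ShiftSet (γ l) (wv l) Λ ⊆ Λ') (Y : Fin nt → FermionOp Λ)
    (nu : ℕ) (b : Fin nu → ℂ) (cw : Fin nu → List (Orb (PolySite Λ') × Bool))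
    (_hcw : ∀ j ∈ (Finset.univ : Finset (Fin nu)), ladderCharge (cw j) ≠ 0 ∨ ladderSpinCharge (cw j) ≠ 0)
    (np : ℕ) (Xp : Fin np → FermionOp Λ') (nm' : ℕ) (Xm : Fin nm' → FermionOp Λ')
    (na : ℕ) (dc : Fin na → ℝ) (V : Fin na → FermionOp Λ')
    (nw : ℕ) (a : Fin nw → ℂ) (word : Fin nw → List (Orb (PolySite Λ') × Bool))
    (c : ℝ),
    WardD4Identity 1 0 8 (7 / 8) hΛ h0 hz μ Λm (fun i => ladderWord (ow i)) Finset.univ B Finset.univ γ wv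
      hsh Y Finset.univ b cw Finset.univ Xp Finset.univ Xm Finset.univ dc V Finset.univ a word c ∧
    (-4 / 5 : ℝ) ≤ c - ∑ k, ‖a k‖ - g * nm

theorem stub_foReplayCert_m4o5 : FoReplayCert_m4o5 := by
  sorry

/-! ### Composition into the crux (kernel-checked, no sorry) -/

/-- **PSD-slack absorption (proved glue)**: a Ward × `D₄` identity with Gram matrix `Λm` on ladder
words is the same identity with Gram matrix `Λm + g·1` and the `#words` extra residual terms
`−g · (wᵢ† ++ wᵢ)`. [folklore] -/
theorem wardD4Identity_slack {t t' U n : ℝ} {Λ Λ' : Finset (Site 2)} (hΛ : Λ ⊆ Λ')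
    (h0 : thicken ({0} : Finset (Site 2)) 1 ⊆ Λ') (hz : (0 : Site 2) ∈ Λ') (μ : ℝ)
    {nm : ℕ} (Λm : Matrix (Fin nm) (Fin nm) ℂ) (g : ℝ) (ow : Fin nm → List (Orb (PolySite Λ') × Bool))
    {κ : Type} (s : Finset κ) (B : κ → FermionOp Λ)
    {ι : Type} (tt : Finset ι) (γ : ι → DihedralGroup 4) (wv : ι → Site 2)
    (hsh : ∀ l, d4ShiftSet (γ l) (wv l) Λ ⊆ Λ') (Y : ι → FermionOp Λ)
    {ρ : Type} (u : Finset ρ) (b : ρ → ℂ) (cw : ρ → List (Orb (PolySite Λ') × Bool))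
    {θ : Type} (wp : Finset θ) (Xp : θ → FermionOp Λ')
    {θ' : Type} (wm : Finset θ') (Xm : θ' → FermionOp Λ')
    {δ : Type} (ah : Finset δ) (dc : δ → ℝ) (V : δ → FermionOp Λ')
    {nw : ℕ} (a : Fin nw → ℂ) (word : Fin nw → List (Orb (PolySite Λ') × Bool)) (c : ℝ)
    (h : WardD4Identity t t' U n hΛ h0 hz μ Λm (fun i => ladderWord (ow i)) s B tt γ wv hsh Y u b cw wp Xp
      wm Xm ah dc V Finset.univ a word c) :
    WardD4Identity t t' U n hΛ h0 hz μ (Λm + ((g : ℝ) : ℂ) • (1 : Matrix (Fin nm) (Fin nm) ℂ))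
      (fun i => ladderWord (ow i)) s B tt γ wv hsh Y u b cw wp Xp wm Xm ah dc V Finset.univ
      (Sum.elim a (fun _ : Fin nm => -((g : ℝ) : ℂ)))
      (Sum.elim word (fun i : Fin nm => ((ow i).map fun p => (p.1, !p.2)).reverse ++ ow i)) c := by
  unfold WardD4Identity at h ⊢
  rw [h, gramForm_add, gramForm_smul_one]
  have hw : ∑ k ∈ (Finset.univ : Finset (Fin nw ⊕ Fin nm)),
      (Sum.elim a (fun _ : Fin nm => -((g : ℝ) : ℂ))) k •
        ladderWord ((Sum.elim word (fun i : Fin nm => ((ow i).map fun p => (p.1, !p.2)).reverse ++ ow i)) k) =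
      ∑ k ∈ (Finset.univ : Finset (Fin nw)), a k • ladderWord (word k) +
        ∑ i : Fin nm, (-((g : ℝ) : ℂ)) • (star (ladderWord (ow i)) * ladderWord (ow i)) := by
    rw [Fintype.sum_sum_type]
    simp only [Sum.elim_inl, Sum.elim_inr, Matrix.star_eq_conjTranspose, conjTranspose_mul_ladderWord_eq]
  rw [hw, Finset.smul_sum]
  simp only [neg_smul, Finset.sum_neg_distrib]
  abel


/-! ## §S  `fo_dual_rounding`'s stub 2 — SLACK ABSORPTION (Jansson–Chaykin–Keil Lemma 3.1 in the window
algebra) — PROVED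

`WardSlackWindowBound` below is a VERBATIM copy of `FoDualRounding.WardSlackWindowBound`
(`Cruxes/LowerEdge_ge_m4o5/Lines/fo_dual_rounding.lean`, seat hub-lb-dual-plan-2 = pen of record per the
captain's ruling 2026-08-28T06:28:34Z); `WardD4Identity` / `WardD4WindowSound` above are the same verbatim
`wardk` text that file copies, so `DualReplay.WardSlackWindowBound` and `FoDualRounding.WardSlackWindowBound`
unfold to the same term and `slackAbsorb_holds` closes `FoDualRounding.stub_slackAbsorb` as it stands
(`wardSlackWindowBound_holds` closes stub 1 ∘ stub 2 outright).  Proof = the docstring route of that stub: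
blocks `Z k ↦ Z k + δ_k • 1` (PSD by hypothesis, direct sum PSD), the defect `−δ_k Σ_i (O k i)ᴴ (O k i)` is
rewritten with the SOS norm factors `(r k i)² • 1 − (O k i)ᴴ (O k i) = (F k i)ᴴ (F k i)` as
`+ δ_k Σ_i (F k i)ᴴ (F k i) − δ_k Σ_i (r k i)² • 1`; the `F`-squares join the Gram slot (multiplier
`fromBlocks (blockDiagonal' Z') 0 0 (diagonal δ)` on `σ ⊕ σ`, generators `Sum.elim O F`), the scalar moves into
the constant: `c ↦ c − Σ_k δ_k Σ_i (r k i)²`. -/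

/-- VERBATIM COPY of `FoDualRounding.WardSlackWindowBound` (fo_dual_rounding.lean §1): the SLACK READER —
Gram blocks `Z k` only NEARLY PSD (`Z k + δ_k • 1 ⪰ 0`, `0 ≤ δ_k`), generators `O k i` with SOS norm
certificates `(r k i)² • 1 − (O k i)ᴴ (O k i) ⪰ 0`; conclusion
`c − Σₖ ‖aₖ‖ − Σ_k δ_k Σ_i (r k i)² ≤ energyDensityTT' t t' U n`. [cite: JanssonChaykinKeil2007, Lemma 3.1] -/
def WardSlackWindowBound : Prop :=
  ∀ (t t' U : ℝ), 0 ≤ U → ∀ (n : ℝ), 0 ≤ n → n < 2 →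
  ∀ (Λ Λ' : Finset (Site 2)) (hΛ : Λ ⊆ Λ') (_h8 : thicken Λ 1 ⊆ Λ')
    (h0 : thicken ({0} : Finset (Site 2)) 1 ⊆ Λ') (hz : (0 : Site 2) ∈ Λ')
    (μ : ℝ)
    (β : Type) (_ : Fintype β) (_ : DecidableEq β) (mb : β → Type) (_ : ∀ k, Fintype (mb k))
    (_ : ∀ k, DecidableEq (mb k))
    (Z : (k : β) → Matrix (mb k) (mb k) ℂ) (δs : β → ℝ) (_hδ : ∀ k, 0 ≤ δs k)
    (_hZ : ∀ k, (Z k + ((δs k : ℝ) : ℂ) • (1 : Matrix (mb k) (mb k) ℂ)).PosSemidef)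
    (O : (k : β) → mb k → FermionOp Λ') (r : (k : β) → mb k → ℝ)
    (_hO : ∀ k i, ((((r k i) ^ 2 : ℝ) : ℂ) • (1 : FermionOp Λ') - (O k i)ᴴ * O k i).PosSemidef)
    (κ : Type) (s : Finset κ) (B : κ → FermionOp Λ)
    (ι : Type) (tt : Finset ι) (γ : ι → DihedralGroup 4) (wv : ι → Site 2)
    (hsh : ∀ l, d4ShiftSet (γ l) (wv l) Λ ⊆ Λ') (Y : ι → FermionOp Λ)
    (ρ : Type) (u : Finset ρ) (b : ρ → ℂ) (cw : ρ → List (Orb (PolySite Λ') × Bool))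
    (_hcw : ∀ j ∈ u, ladderCharge (cw j) ≠ 0 ∨ ladderSpinCharge (cw j) ≠ 0)
    (θ : Type) (wp : Finset θ) (Xp : θ → FermionOp Λ')
    (θ' : Type) (wm : Finset θ') (Xm : θ' → FermionOp Λ')
    (δ : Type) (ah : Finset δ) (dc : δ → ℝ) (V : δ → FermionOp Λ')
    (κ'' : Type) (w : Finset κ'') (a : κ'' → ℂ) (word : κ'' → List (Orb (PolySite Λ') × Bool))
    (c : ℝ),
    WardD4Identity t t' U n hΛ h0 hz μ (Matrix.blockDiagonal' Z) (fun p : (k : β) × mb k => O p.1 p.2)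
      s B tt γ wv hsh Y u b cw wp Xp wm Xm ah dc V w a word c →
    c - ∑ k ∈ w, ‖a k‖ - ∑ k, δs k * ∑ i, (r k i) ^ 2 ≤ energyDensityTT' t t' U n

/-- A block-diagonal `fromBlocks A 0 0 D` with PSD diagonal blocks is PSD. [folklore] -/
theorem posSemidef_fromBlocks_diag {p : Type*} [Fintype p] {A D : Matrix p p ℂ} (hA : A.PosSemidef)
    (hD : D.PosSemidef) : (Matrix.fromBlocks A 0 0 D).PosSemidef := by
  refine PosSemidef.of_dotProduct_mulVec_nonneg (hA.1.fromBlocks (by simp) hD.1) fun x => ?_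
  have hx : star x = Sum.elim (star (x ∘ Sum.inl)) (star (x ∘ Sum.inr)) := by
    ext (i | i) <;> rfl
  rw [fromBlocks_mulVec, zero_mulVec, zero_mulVec, add_zero, zero_add, hx,
    sumElim_dotProduct_sumElim]
  exact add_nonneg (hA.dotProduct_mulVec_nonneg _) (hD.dotProduct_mulVec_nonneg _)

/-- A PSD complex matrix is a hermitian square `Fᴴ F` (C⋆-algebra square root). [folklore] -/
theorem exists_conjTranspose_mul_self_of_posSemidef {p : Type*} [Fintype p] [DecidableEq p]
    {P : Matrix p p ℂ} (hP : P.PosSemidef) : ∃ F : Matrix p p ℂ, P = Fᴴ * F := by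
  open scoped MatrixOrder in
  obtain ⟨F, hF⟩ := CStarAlgebra.nonneg_iff_eq_star_mul_self.mp hP.nonneg
  exact ⟨F, by simpa only [Matrix.star_eq_conjTranspose] using hF⟩

/-- A dependent block-diagonal matrix with PSD blocks is PSD (`⇐` of Horn–Johnson 7.1.P6). [folklore] -/
theorem posSemidef_blockDiagonal'_of {β : Type*} [Fintype β] [DecidableEq β] {mb : β → Type*}
    [∀ k, Fintype (mb k)] [∀ k, DecidableEq (mb k)] (M : (k : β) → Matrix (mb k) (mb k) ℂ)
    (h : ∀ k, (M k).PosSemidef) : (Matrix.blockDiagonal' M).PosSemidef := by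
  choose F hF using fun k => exists_conjTranspose_mul_self_of_posSemidef (h k)
  have e : Matrix.blockDiagonal' M = (Matrix.blockDiagonal' F)ᴴ * Matrix.blockDiagonal' F := by
    rw [Matrix.blockDiagonal'_conjTranspose, ← Matrix.blockDiagonal'_mul]
    congr 1
    funext k
    exact hF k
  rw [e]
  exact Matrix.posSemidef_conjTranspose_mul_self _

/-- Gram element of a block-diagonal `2 × 2` block multiplier on `Sum.elim` generators. [folklore] -/
theorem gramForm_fromBlocks_diag {𝓐 : Type*} [Ring 𝓐] [StarRing 𝓐] [Algebra ℂ 𝓐] {p q : Type*}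
    [Fintype p] [Fintype q] (A : Matrix p p ℂ) (D : Matrix q q ℂ) (O : p → 𝓐) (F : q → 𝓐) :
    gramForm (Matrix.fromBlocks A 0 0 D) (Sum.elim O F) = gramForm A O + gramForm D F := by
  unfold gramForm
  simp only [Fintype.sum_sum_type, Matrix.fromBlocks_apply₁₁, Matrix.fromBlocks_apply₁₂,
    Matrix.fromBlocks_apply₂₁, Matrix.fromBlocks_apply₂₂, Sum.elim_inl, Sum.elim_inr, Matrix.zero_apply,
    zero_smul, Finset.sum_const_zero, add_zero, zero_add]

/-- Gram element of a diagonal multiplier. [folklore] -/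
theorem gramForm_diagonal' {𝓐 : Type*} [Ring 𝓐] [StarRing 𝓐] [Algebra ℂ 𝓐] {p : Type*} [Fintype p]
    [DecidableEq p] (d : p → ℂ) (O : p → 𝓐) :
    gramForm (Matrix.diagonal d) O = ∑ i, d i • (star (O i) * O i) := by
  unfold gramForm
  refine Finset.sum_congr rfl fun i _ => ?_
  rw [Finset.sum_eq_single i]
  · rw [Matrix.diagonal_apply_eq]
  · intro j _ hji
    rw [Matrix.diagonal_apply_ne _ (Ne.symm hji), zero_smul]
  · intro hi
    exact absurd (Finset.mem_univ i) hi

/-- `blockDiagonal'` of scalar blocks `δ_k • 1` is the diagonal matrix `p ↦ δ_{p.1}`. [folklore] -/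
theorem blockDiagonal'_smul_one_eq_diagonal {β : Type*} [DecidableEq β] {mb : β → Type*}
    [∀ k, DecidableEq (mb k)] (δs : β → ℝ) :
    (Matrix.blockDiagonal' fun k => ((δs k : ℝ) : ℂ) • (1 : Matrix (mb k) (mb k) ℂ)) =
      Matrix.diagonal fun p : (k : β) × mb k => ((δs p.1 : ℝ) : ℂ) := by
  have h : (fun k => ((δs k : ℝ) : ℂ) • (1 : Matrix (mb k) (mb k) ℂ)) =
      fun k => Matrix.diagonal fun _ : mb k => ((δs k : ℝ) : ℂ) := by
    funext k
    ext i j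
    by_cases hij : i = j
    · subst hij
      simp
    · simp [Matrix.one_apply_ne hij, Matrix.diagonal_apply_ne _ hij]
  rw [h, Matrix.blockDiagonal'_diagonal]

/-- **`fo_dual_rounding` stub 2 (SLACK ABSORPTION) — PROVED.** `WardD4WindowSound → WardSlackWindowBound`.
[cite: JanssonChaykinKeil2007, Lemma 3.1] -/
theorem slackAbsorb_holds : WardD4WindowSound → WardSlackWindowBound := by
  intro hW t t' U hU n hn0 hn2 Λ Λ' hΛ h8 h0 hz μ β iβF iβD mb imF imD Z δs hδ hZ O r hO κ s B ι tt γ wv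
    hsh Y ρ u b cw hcw θ wp Xp θ' wm Xm δ ah dc V κ'' w a word c hid
  -- SOS norm factors of the generators
  choose F hF using fun p : (k : β) × mb k => exists_conjTranspose_mul_self_of_posSemidef (hO p.1 p.2)
  set S : ℝ := ∑ k, δs k * ∑ i, (r k i) ^ 2 with hSdef
  -- the exactly-PSD multiplier on `σ ⊕ σ`
  let Z' : (k : β) → Matrix (mb k) (mb k) ℂ := fun k => Z k + ((δs k : ℝ) : ℂ) • 1
  let Dg : Matrix ((k : β) × mb k) ((k : β) × mb k) ℂ := Matrix.diagonal fun p => ((δs p.1 : ℝ) : ℂ)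
  let Λ2 : Matrix (((k : β) × mb k) ⊕ ((k : β) × mb k)) (((k : β) × mb k) ⊕ ((k : β) × mb k)) ℂ :=
    Matrix.fromBlocks (Matrix.blockDiagonal' Z') 0 0 Dg
  have hDg : Dg.PosSemidef :=
    Matrix.posSemidef_diagonal_iff.2 fun p => Complex.zero_le_real.2 (hδ p.1)
  have hΛ2 : Λ2.PosSemidef := posSemidef_fromBlocks_diag (posSemidef_blockDiagonal'_of Z' hZ) hDg
  let O' : ((k : β) × mb k) → FermionOp Λ' := fun p => O p.1 p.2
  let O2 : ((k : β) × mb k) ⊕ ((k : β) × mb k) → FermionOp Λ' := Sum.elim O' F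
  -- the Gram computation
  have hZ' : Matrix.blockDiagonal' Z' = Matrix.blockDiagonal' Z + Dg := by
    show Matrix.blockDiagonal' (Z + fun k => ((δs k : ℝ) : ℂ) • (1 : Matrix (mb k) (mb k) ℂ)) = _
    rw [Matrix.blockDiagonal'_add, blockDiagonal'_smul_one_eq_diagonal]
  have hp : ∀ p : (k : β) × mb k,
      ((δs p.1 : ℝ) : ℂ) • (star (O' p) * O' p) + ((δs p.1 : ℝ) : ℂ) • (star (F p) * F p) =
        (((δs p.1 * (r p.1 p.2) ^ 2 : ℝ)) : ℂ) • (1 : FermionOp Λ') := by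
    intro p
    have hsq : star (O' p) * O' p + star (F p) * F p = ((((r p.1 p.2) ^ 2 : ℝ)) : ℂ) • (1 : FermionOp Λ') := by
      rw [Matrix.star_eq_conjTranspose, Matrix.star_eq_conjTranspose, ← hF p]
      show (O p.1 p.2)ᴴ * O p.1 p.2 + _ = _
      abel
    rw [← smul_add, hsq, smul_smul, ← Complex.ofReal_mul]
  have hG : gramForm Λ2 O2 = gramForm (Matrix.blockDiagonal' Z) O' + ((S : ℝ) : ℂ) • (1 : FermionOp Λ') := by
    show gramForm (Matrix.fromBlocks (Matrix.blockDiagonal' Z') 0 0 Dg) (Sum.elim O' F) = _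
    rw [gramForm_fromBlocks_diag, hZ', gramForm_add, gramForm_diagonal', gramForm_diagonal', add_assoc,
      ← Finset.sum_add_distrib, Finset.sum_congr rfl fun p _ => hp p, ← Finset.sum_smul,
      ← Complex.ofReal_sum]
    congr 3
    rw [hSdef, Fintype.sum_sigma]
    simp only [Finset.mul_sum]
  -- the exact identity with the new constant
  have hid2 : WardD4Identity t t' U n hΛ h0 hz μ Λ2 O2 s B tt γ wv hsh Y u b cw wp Xp wm Xm ah dc V w a
      word (c - S) := by
    unfold WardD4Identity at hid ⊢
    rw [hG, Complex.ofReal_sub, sub_smul]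
    have key : ∀ (E T G N R X : FermionOp Λ') (cc : ℂ),
        E - cc • (1 : FermionOp Λ') - T = G + N + R → E - (cc • 1 - X) - T = G + X + N + R := by
      intro E T G N R X cc h
      rw [show E - (cc • 1 - X) - T = (E - cc • 1 - T) + X by abel, h]
      abel
    exact key _ _ _ _ _ _ _ hid
  have hb := hW t t' U hU n hn0 hn2 Λ Λ' hΛ h8 h0 hz μ (((k : β) × mb k) ⊕ ((k : β) × mb k)) inferInstance
    inferInstance Λ2 hΛ2 O2 κ s B ι tt γ wv hsh Y ρ u b cw hcw θ wp Xp θ' wm Xm δ ah dc V κ'' w a word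
    (c - S) hid2
  linarith

/-- **`fo_dual_rounding` stubs 1 ∘ 2 outright: the slack reader is SOUND.** [folklore] -/
theorem wardSlackWindowBound_holds : WardSlackWindowBound := slackAbsorb_holds wardD4WindowSound_holds

/-! ## §R  The skeleton OF RECORD, discharged to its edition stub

`NearCertWardSlack_m4o5` below is a VERBATIM copy of `FoDualRounding.NearCertWardSlack_m4o5` (fo_dual_rounding.lean §1, stub 3 = the
near-certificate EDITION the lb-dual engines are to produce).  With stubs 1 and 2 of that file PROVED above
(`wardD4WindowSound_holds`, `slackAbsorb_holds`), its composition `exists_lowerRow_of_stubs` runs with NO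
remaining hypothesis but the edition: `lowerRow_of_nearCert` — the crux `LowerEdge_ge_m4o5` follows from
`NearCertWardSlack_m4o5` ALONE, kernel-checked here (hypothesis form; the registered skeleton theorem of record stays in
fo_dual_rounding.lean, this file registers nothing). -/

/-- VERBATIM COPY of `FoDualRounding.NearCertWardSlack_m4o5`: a near-certificate of value `≥ −4/5` at `(1,0,8,7/8)` in
checker normal form (per-block nearly-PSD Gram data with floors `δ_k`, SOS generator-norm weights, Ward × `D₄`
null data, `ℓ¹` residual). [cite: JanssonChaykinKeil2007, Lemma 3.1; Han2020Bootstrap, §3] -/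
def NearCertWardSlack_m4o5 : Prop :=
  ∃ (Λ Λ' : Finset (Site 2)) (hΛ : Λ ⊆ Λ') (_h8 : thicken Λ 1 ⊆ Λ')
    (h0 : thicken ({0} : Finset (Site 2)) 1 ⊆ Λ') (hz : (0 : Site 2) ∈ Λ')
    (μ : ℝ)
    (nb : ℕ) (msz : Fin nb → ℕ) (Z : (k : Fin nb) → Matrix (Fin (msz k)) (Fin (msz k)) ℂ)
    (δs : Fin nb → ℝ) (_hδ : ∀ k, 0 ≤ δs k)
    (_hZ : ∀ k, (Z k + ((δs k : ℝ) : ℂ) • (1 : Matrix (Fin (msz k)) (Fin (msz k)) ℂ)).PosSemidef)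
    (O : (k : Fin nb) → Fin (msz k) → FermionOp Λ') (r : (k : Fin nb) → Fin (msz k) → ℝ)
    (_hO : ∀ k i, ((((r k i) ^ 2 : ℝ) : ℂ) • (1 : FermionOp Λ') - (O k i)ᴴ * O k i).PosSemidef)
    (ns : ℕ) (B : Fin ns → FermionOp Λ)
    (nt : ℕ) (γ : Fin nt → DihedralGroup 4) (wv : Fin nt → Site 2)
    (hsh : ∀ l, d4ShiftSet (γ l) (wv l) Λ ⊆ Λ') (Y : Fin nt → FermionOp Λ)
    (nu : ℕ) (b : Fin nu → ℂ) (cw : Fin nu → List (Orb (PolySite Λ') × Bool))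
    (_hcw : ∀ j ∈ (Finset.univ : Finset (Fin nu)), ladderCharge (cw j) ≠ 0 ∨ ladderSpinCharge (cw j) ≠ 0)
    (np : ℕ) (Xp : Fin np → FermionOp Λ') (nm' : ℕ) (Xm : Fin nm' → FermionOp Λ')
    (na : ℕ) (dc : Fin na → ℝ) (V : Fin na → FermionOp Λ')
    (nw : ℕ) (a : Fin nw → ℂ) (word : Fin nw → List (Orb (PolySite Λ') × Bool))
    (c : ℝ),
    WardD4Identity 1 0 8 (7 / 8) hΛ h0 hz μ (Matrix.blockDiagonal' Z)
      (fun p : (k : Fin nb) × Fin (msz k) => O p.1 p.2) Finset.univ B Finset.univ γ wv hsh Y Finset.univ b cw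
      Finset.univ Xp Finset.univ Xm Finset.univ dc V Finset.univ a word c ∧
    (-4 / 5 : ℝ) ≤ c - ∑ k, ‖a k‖ - ∑ k, δs k * ∑ i, (r k i) ^ 2

/-- **The skeleton of record with stubs 1–2 discharged**: the edition ALONE gives the certified lower row
`lo = −4/5` (fo_dual_rounding's `exists_lowerRow_of_stubs` fed with `wardD4WindowSound_holds` and
`slackAbsorb_holds`). [folklore] -/
theorem lowerRow_of_nearCert :
    NearCertWardSlack_m4o5 → ∃ lo : ℚ, (-4 / 5 : ℚ) ≤ lo ∧ Summit.Ventures.CertifiedManyBodySolver.M3EnergyLowerRow 0 lo := by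
  intro h₃
  have hS : WardSlackWindowBound := slackAbsorb_holds wardD4WindowSound_holds
  obtain ⟨Λ, Λ', hΛ, h8, h0, hz, μ, nb, msz, Z, δs, hδ, hZ, O, r, hO, ns, B, nt, γ, wv, hsh, Y, nu, b, cw, hcw,
    np, Xp, nm', Xm, na, dc, V, nw, a, word, c, hcert, hval⟩ := h₃
  have hb := hS 1 0 8 (by norm_num) (7 / 8) (by norm_num) (by norm_num) Λ Λ' hΛ h8 h0 hz μ
    (Fin nb) inferInstance inferInstance (fun k => Fin (msz k)) inferInstance inferInstance Z δs hδ hZ O r hO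
    (Fin ns) Finset.univ B (Fin nt) Finset.univ γ wv hsh Y (Fin nu) Finset.univ b cw hcw
    (Fin np) Finset.univ Xp (Fin nm') Finset.univ Xm (Fin na) Finset.univ dc V (Fin nw) Finset.univ a word c hcert
  refine ⟨-4 / 5, le_rfl, ?_⟩
  unfold Summit.Ventures.CertifiedManyBodySolver.M3EnergyLowerRow
  have hcast : (((-4 / 5 : ℚ) : ℚ) : ℝ) = (-4 / 5 : ℝ) := by push_cast; ring
  rw [hcast]
  linarith


theorem lowerEdge_ge_m4o5_of_hyp :
    PsdOfFactorRowsum → FoReplayCert_m4o5 →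
    Summit.Ventures.CertifiedManyBodySolver.Theses.M3PrimeEdgeSplit.LowerEdge_ge_m4o5 := by
  intro hP hF
  obtain ⟨Λ, Λ', hΛ, h8, h0, hz, μ, nm, Λm, hΛh, nr, Lc, g, hg0, hg, ow, ns, B, nt, γ, wv, hsh, Y, nu, b, cw,
    hcw, np, Xp, nm', Xm, na, dc, V, nw, a, word, c, hcert, hval⟩ := hF
  have hpsd : (Λm + ((g : ℝ) : ℂ) • (1 : Matrix (Fin nm) (Fin nm) ℂ)).PosSemidef := hP nm nr Λm hΛh Lc g hg
  have hcert' := wardD4Identity_slack hΛ h0 hz μ Λm g ow Finset.univ B Finset.univ γ wv hsh Y Finset.univ b cw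
    Finset.univ Xp Finset.univ Xm Finset.univ dc V a word c hcert
  have hS := wardD4WindowSound_holds 1 0 8 (by norm_num) (7 / 8) (by norm_num) (by norm_num) Λ Λ' hΛ h8 h0 hz μ
    (Fin nm) inferInstance inferInstance (Λm + ((g : ℝ) : ℂ) • (1 : Matrix (Fin nm) (Fin nm) ℂ)) hpsd
    (fun i => ladderWord (ow i)) (Fin ns) Finset.univ B (Fin nt) Finset.univ γ wv hsh Y (Fin nu) Finset.univ b
    cw hcw (Fin np) Finset.univ Xp (Fin nm') Finset.univ Xm (Fin na) Finset.univ dc V (Fin nw ⊕ Fin nm)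
    Finset.univ (Sum.elim a (fun _ : Fin nm => -((g : ℝ) : ℂ)))
    (Sum.elim word (fun i : Fin nm => ((ow i).map fun p => (p.1, !p.2)).reverse ++ ow i)) c hcert'
  have hnorm : ∑ k ∈ (Finset.univ : Finset (Fin nw ⊕ Fin nm)), ‖(Sum.elim a (fun _ : Fin nm => -((g : ℝ) : ℂ))) k‖ =
      ∑ k, ‖a k‖ + g * nm := by
    rw [Fintype.sum_sum_type]
    simp only [Sum.elim_inl, Sum.elim_inr, norm_neg, Complex.norm_real, Real.norm_eq_abs, abs_of_nonneg hg0,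
      Finset.sum_const, Finset.card_univ, Fintype.card_fin, nsmul_eq_mul]
    ring
  rw [hnorm] at hS
  show Summit.Ventures.CertifiedManyBodySolver.MbsolverRungLeaves.M3Lower_tp0_ge_m4o5
  refine ⟨-4 / 5, le_rfl, ?_⟩
  show (((-4 / 5 : ℚ) : ℝ)) ≤ energyDensityTT' 1 0 8 (7 / 8)
  push_cast
  linarith

/-- THE SKELETON THEOREM of line `dualreplay`: the crux `LowerEdge_ge_m4o5` BY NAME from the two
registered stubs `stub_psdOfFactorRowsum` (G1) and `stub_foReplayCert_m4o5` (G3), through the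
sorry-free hypothesis form `lowerEdge_ge_m4o5_of_hyp`. -/
theorem LowerEdge_ge_m4o5_of :
    Summit.Ventures.CertifiedManyBodySolver.Theses.M3PrimeEdgeSplit.LowerEdge_ge_m4o5 :=
  lowerEdge_ge_m4o5_of_hyp stub_psdOfFactorRowsum stub_foReplayCert_m4o5

end Summit.Ventures.CertifiedManyBodySolver.Cruxes.LowerEdge_ge_m4o5.DualReplay

end
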